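import Summits.QuantumFields.BalabanUV.T4Continuum.Support.NE7K1LinStripClassSums
import Literature.MathematicalPhysics.QuantumFieldTheory.Balaban1983to89.B4StripSumsDeriv

/-!
# NE7K1LinStripClassSumsDeriv — row NE7 (node U5), candidate route HOM, path H1L, cell K1-lin(s): NEEDS-ESTIMATE #E1, R-E1 TRANCHE D —
# b04's `B4StripSumsDeriv` §3–§6 RE-TYPED OVER THE CLASS `S`: the DIFFERENTIATED (2.49) multiplier `GDS n σ a τ μ = Σ_k D_n(k_μ)·F·RS_k∕ES`
# of `∂^ξ_μ(σ + aQ*Q)⁻¹Q*`, its `n`-uniform bound, holomorphy, side periodicity, `StripRegular`, and THE DECAY OF ITS LATTICE KERNEL —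
# B4 (2.35), SECOND QUANTITY, for every `σ ∈ S`, constants in `(d, a₋, a₊, r, C_up)` ONLY

Lineage `b2b-balaban-t4-ne7-p2` (CRUX PROVER NE7 #2), generation 76; file 69.  File 67 typed the undifferentiated multiplier `GS` over S.
b04's derivative file needs from the symbol only the regrouped ratio's quadratic gain (`norm_R_le_split` ← `re_DeltaXi_shift_ge_W`);
everything else — the difference-derivative symbol `D_n`, its cancellation `D·v` against the averaging factor, the split residue sums
`inv_W_le_split ∕ sum_split_le`, `D_tr` — is symbol-independent and used BY NAME.  THIS FILE ([folklore]):

* §1 **`termDS`** `= D_n(k_μ; p_μ)·termS`, **`GDS n σ a τ μ`** `= Σ_k termDS`; `termD_eq_termDS ∕ GD_eq_GDS` (`rfl`).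
* §2 the `n`-UNIFORM BOUND: `norm_RS_le_split` (`‖RS_k‖ ≤ CRS·ω(k_μ)^{−3∕2}·Π_{ν≠μ} ω^{−1∕(2(d+1))}`, the class floor `¼W` + b04's split),
  `norm_termDS_le`, **`norm_GDS_le`**: `‖GDS‖ ≤ boundGDS d c C_up = c⁻¹·12CRS·2ζ(3∕2)(48ζ(s_d))^d` where `c ≤ ‖ES‖`.
* §3 holomorphy `differentiableAt_termDS ∕ _GDS`; §4 side periodicity `termDS_tr_side ∕ GDS_tr_side` (file 67's `termS_tr_side` + `D_tr`).
* §5 **`stripRegular_GDS`**, **`GDS_stripRegular`** (class strip `κ_S`, bound `boundGDS (d) (cS (d+1) a₋) C_up`), **`dkernelS_decay`**: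
  `‖latticeKernel (GDS n σ a τ μ) x‖ ≤ boundGDS·e^{−κ_S|x|_∞}` — for EVERY `σ ∈ S(n; r, C_S, C_up)`, `a ∈ [a₋,a₊]`, `τ`, `μ`, `x`.

The line ∕ torus corollaries of the second quantity are file 70.  The Hölder quotient (2.36) over S (b04's `B4StripSumsHolder`) remains.

HONEST FRAMING: [folklore]; b04's bookkeeping with one symbol letter generalised; multiplier-level statements (the operator identity
`∂^ξ_μ` ↔ `n·[K(·+e_μ) − K]` is b04's `B4Green242Bridge` dictionary, not re-derived); nothing of Bałaban's asserted; no `sorry`.  Census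
only; NE7 NOT PRINTED ∕ NOT PROVED; spine 0∕9; FIXED FINITE T⁴, rung (B)+1; NOT infinite volume, NOT mass gap, NOT Clay.  HONEST DEPENDENCY:
continuum YM on T⁴ ⇐ BetaPertH ∧ nine spine estimates (0/9 proved); BetaPertH ⇐ (D1) ∧ (D4) ∧ CAP+tail; G-an2-4 gates asym, D1 and NE2/3/4.
-/

noncomputable section

open Finset Complex Set

namespace Summit.QuantumFields.BalabanUV.T4Continuum.NE7K1LinStripClassSumsDeriv

open Literature.MathematicalPhysics.QuantumFieldTheory.Balaban1983to89
open Literature.MathematicalPhysics.QuantumFieldTheory.Balaban1983to89.B4Strip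
open Literature.MathematicalPhysics.QuantumFieldTheory.Balaban1983to89.B4StripCauchy
open Literature.MathematicalPhysics.QuantumFieldTheory.Balaban1983to89.B4StripSums
open Literature.MathematicalPhysics.QuantumFieldTheory.Balaban1983to89.B4StripSumsDeriv
open Literature.MathematicalPhysics.QuantumFieldTheory.Balaban1983to89.B5Strip145Analytic
open Literature.MathematicalPhysics.QuantumFieldTheory.Balaban1983to89.B5Strip145Decay
open Literature.MathematicalPhysics.QuantumFieldTheory.Balaban1983to89.B4ContourShift
open NE7K1LinStripClass NE7K1LinStripClassCauchy NE7K1LinStripClassSums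

variable {d : ℕ}

/-! ### §1 The differentiated multiplier over the class -/

/-- one term of the DIFFERENTIATED `l`-sum over the class: `D_n(k_μ; p_μ)·termS_k(p)`. [folklore] -/
def termDS (n : ℕ) [NeZero n] (σ : (Fin d → ℂ) → ℂ) (a : ℝ) (τ : Fin d → Fin n) (μ : Fin d) (k : Fin d → Fin n)
    (p : Fin d → ℂ) : ℂ :=
  D n (k μ : ℕ) (p μ) * termS n σ a τ k p

/-- THE FOURIER MULTIPLIER OF `∂^ξ_μ(σ + aQ*Q)⁻¹Q*` AT BLOCK OFFSET `τ` over the class (b04's `GD` with `Δ^ξ_n + m² ↦ σ`). [folklore] -/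
def GDS (n : ℕ) [NeZero n] (σ : (Fin d → ℂ) → ℂ) (a : ℝ) (τ : Fin d → Fin n) (μ : Fin d) (p : Fin d → ℂ) : ℂ :=
  ∑ k : Fin d → Fin n, termDS n σ a τ μ k p

/-- b04's differentiated term IS the class one at the block Laplacian. [folklore] -/
theorem termD_eq_termDS (n : ℕ) [NeZero n] (a m2 : ℝ) (τ : Fin d → Fin n) (μ : Fin d) (k : Fin d → Fin n) (p : Fin d → ℂ) :
    termD n a m2 τ μ k p = termDS n (DeltaXi n m2) a τ μ k p := rfl

/-- b04's differentiated multiplier IS the class one at the block Laplacian. [folklore] -/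
theorem GD_eq_GDS (n : ℕ) [NeZero n] (a m2 : ℝ) (τ : Fin d → Fin n) (μ : Fin d) (p : Fin d → ℂ) :
    GD n a m2 τ μ p = GDS n (DeltaXi n m2) a τ μ p := rfl

variable {n : ℕ} {σ : (Fin (d + 1) → ℂ) → ℂ} {r CS Cup : ℝ}

/-! ### §2 The `n`-uniform bound on the fat region -/

/-- `‖RS_k‖ ≤ CRS·ω_n(k_μ)^{−3∕2}·Π_{ν≠μ} ω_n(k_ν)^{−1∕(2(d+1))}` for EVERY `k` on the fat region (the split form of the quadratic gain
over the class). [folklore] -/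
theorem norm_RS_le_split [NeZero n] (h : SymbS n σ r CS Cup) {q : Fin (d + 1) → ℂ} (hq : q ∈ Fat (d + 1) r)
    (k : Fin (d + 1) → Fin n) (μ : Fin (d + 1)) :
    ‖RS n σ k q‖ ≤ CRS Cup * (omega n (k μ) ^ (-(3 / 2 : ℝ))
      * ∏ i : Fin d, omega n (k (μ.succAbove i)) ^ (-(1 : ℝ) / (2 * (d + 1)))) := by
  have hn : 1 ≤ n := Nat.one_le_iff_ne_zero.mpr (NeZero.ne n)
  have hC := h.cup_nonneg
  have hCR1 : 1 ≤ CRS Cup := by unfold CRS; linarith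
  by_cases hk : k = fun _ => 0
  · have h1 : ‖RS n σ k q‖ = 1 := by unfold RS; rw [if_pos hk, norm_one]
    have h2 : omega n (k μ) ^ (-(3 / 2 : ℝ)) = 1 := by
      rw [hk, Fin.val_zero, omega_zero n hn, Real.one_rpow]
    have h3 : ∏ i : Fin d, omega n (k (μ.succAbove i)) ^ (-(1 : ℝ) / (2 * (d + 1))) = 1 := by
      refine Finset.prod_eq_one (fun i _ => ?_)
      rw [hk, Fin.val_zero, omega_zero n hn, Real.one_rpow]
    rw [h1, h2, h3, mul_one, mul_one]
    exact hCR1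
  · have h1 := norm_RS_le h hq k hk
    have h2 := inv_W_le_split n k hk μ
    have hP0 : 0 ≤ omega n (k μ) ^ (-(3 / 2 : ℝ))
        * ∏ i : Fin d, omega n (k (μ.succAbove i)) ^ (-(1 : ℝ) / (2 * (d + 1))) :=
      mul_nonneg (Real.rpow_nonneg (omega_pos n _ (k μ).isLt).le _)
        (Finset.prod_nonneg (fun i _ => Real.rpow_nonneg (omega_pos n _ (k (μ.succAbove i)).isLt).le _))
    calc ‖RS n σ k q‖ ≤ 4 * Cup / W n k := h1
      _ = 4 * Cup * (1 / W n k) := by ring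
      _ ≤ 4 * Cup * (omega n (k μ) ^ (-(3 / 2 : ℝ))
          * ∏ i : Fin d, omega n (k (μ.succAbove i)) ^ (-(1 : ℝ) / (2 * (d + 1)))) :=
          mul_le_mul_of_nonneg_left h2 (by positivity)
      _ ≤ CRS Cup * (omega n (k μ) ^ (-(3 / 2 : ℝ))
          * ∏ i : Fin d, omega n (k (μ.succAbove i)) ^ (-(1 : ℝ) / (2 * (d + 1)))) :=
          mul_le_mul_of_nonneg_right (by unfold CRS; linarith) hP0

/-- the bound of one differentiated term on the fat region where `‖ES‖ ≥ c`:
`‖termDS_k‖ ≤ c⁻¹·12CRS·ω_n(k_μ)^{−3∕2}·Π_{ν≠μ} 24ω_n(k_ν)^{−s_d}`. [folklore] -/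
theorem norm_termDS_le [NeZero n] (h : SymbS n σ r CS Cup) (a : ℝ) {p : Fin (d + 1) → ℂ} (hp : p ∈ Fat (d + 1) r) {c : ℝ}
    (hc : 0 < c) (hE : c ≤ ‖ES n σ a p‖) (τ : Fin (d + 1) → Fin n) (μ : Fin (d + 1)) (k : Fin (d + 1) → Fin n) :
    ‖termDS n σ a τ μ k p‖ ≤ c⁻¹ * (12 * CRS Cup)
      * (omega n (k μ) ^ (-(3 / 2 : ℝ)) * ∏ i : Fin d, 24 * omega n (k (μ.succAbove i)) ^ (-(sD d))) := by
  have hterm : termDS n σ a τ μ k p = D n (k μ : ℕ) (p μ) * F n τ k p * RS n σ k p / ES n σ a p := by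
    unfold termDS termS; ring
  rw [hterm, norm_div, norm_mul]
  have hF := norm_D_mul_F_le n h.r_le τ k μ hp
  have hR := norm_RS_le_split h hp k μ
  have hE' : ‖ES n σ a p‖⁻¹ ≤ c⁻¹ := inv_anti₀ hc hE
  have hP1 : 0 ≤ 12 * ∏ i : Fin d, 24 / omega n (k (μ.succAbove i)) :=
    mul_nonneg (by norm_num) (Finset.prod_nonneg (fun i _ =>
      div_nonneg (by norm_num) (omega_pos n _ (k (μ.succAbove i)).isLt).le))
  have hωμ : 0 ≤ omega n (k μ) ^ (-(3 / 2 : ℝ)) := Real.rpow_nonneg (omega_pos n _ (k μ).isLt).le _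
  have hP0 : 0 ≤ ∏ i : Fin d, omega n (k (μ.succAbove i)) ^ (-(1 : ℝ) / (2 * (d + 1))) :=
    Finset.prod_nonneg (fun i _ => Real.rpow_nonneg (omega_pos n _ (k (μ.succAbove i)).isLt).le _)
  have hCR := CRS_nonneg h.cup_nonneg
  have hprod : (∏ i : Fin d, 24 / omega n (k (μ.succAbove i)))
      * ∏ i : Fin d, omega n (k (μ.succAbove i)) ^ (-(1 : ℝ) / (2 * (d + 1)))
      = ∏ i : Fin d, 24 * omega n (k (μ.succAbove i)) ^ (-(sD d)) := by
    rw [← Finset.prod_mul_distrib]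
    refine Finset.prod_congr rfl (fun i _ => ?_)
    have hω := omega_pos n _ (k (μ.succAbove i)).isLt
    rw [div_eq_mul_inv, ← Real.rpow_neg_one, mul_assoc, ← Real.rpow_add hω]
    congr 1
    unfold sD
    field_simp
    ring
  calc ‖D n (k μ : ℕ) (p μ) * F n τ k p‖ * ‖RS n σ k p‖ / ‖ES n σ a p‖
      = ‖D n (k μ : ℕ) (p μ) * F n τ k p‖ * ‖RS n σ k p‖ * ‖ES n σ a p‖⁻¹ := div_eq_mul_inv _ _
    _ ≤ ((12 * ∏ i : Fin d, 24 / omega n (k (μ.succAbove i)))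
          * (CRS Cup * (omega n (k μ) ^ (-(3 / 2 : ℝ))
            * ∏ i : Fin d, omega n (k (μ.succAbove i)) ^ (-(1 : ℝ) / (2 * (d + 1)))))) * c⁻¹ := by
        apply mul_le_mul (mul_le_mul hF hR (norm_nonneg _) hP1) hE' (inv_nonneg.mpr (norm_nonneg _))
        positivity
    _ = c⁻¹ * (12 * CRS Cup) * (omega n (k μ) ^ (-(3 / 2 : ℝ))
          * ((∏ i : Fin d, 24 / omega n (k (μ.succAbove i)))
            * ∏ i : Fin d, omega n (k (μ.succAbove i)) ^ (-(1 : ℝ) / (2 * (d + 1))))) := by ring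
    _ = c⁻¹ * (12 * CRS Cup)
          * (omega n (k μ) ^ (-(3 / 2 : ℝ)) * ∏ i : Fin d, 24 * omega n (k (μ.succAbove i)) ^ (-(sD d))) := by
        rw [hprod]

/-- the uniform bound `boundGDS d c C_up = c⁻¹·12CRS(C_up)·2ζ(3∕2)·(48ζ(s_d))^d` of the differentiated class multiplier. [folklore] -/
def boundGDS (d : ℕ) (c Cup : ℝ) : ℝ := c⁻¹ * (12 * CRS Cup) * (2 * zetaS (3 / 2) * (48 * zetaS (sD d)) ^ d)

/-- `boundGDS ≥ 0`. [folklore] -/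
theorem boundGDS_nonneg (d : ℕ) {c Cup : ℝ} (hc : 0 < c) (hC : 0 ≤ Cup) : 0 ≤ boundGDS d c Cup := by
  unfold boundGDS
  have := CRS_nonneg hC
  have := zetaS_nonneg (3 / 2)
  have := zetaS_nonneg (sD d)
  positivity

/-- **THE UNIFORM BOUND OF THE DIFFERENTIATED CLASS MULTIPLIER ON THE FAT REGION**: where `‖ES(p′)‖ ≥ c > 0`,
`‖GDS n σ a τ μ p′‖ ≤ boundGDS d c C_up` — independent of `n`, `τ`, `μ`, `a`, and of `σ` beyond `C_up`. [folklore] -/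
theorem norm_GDS_le [NeZero n] (h : SymbS n σ r CS Cup) (a : ℝ) {p : Fin (d + 1) → ℂ} (hp : p ∈ Fat (d + 1) r) {c : ℝ}
    (hc : 0 < c) (hE : c ≤ ‖ES n σ a p‖) (τ : Fin (d + 1) → Fin n) (μ : Fin (d + 1)) :
    ‖GDS n σ a τ μ p‖ ≤ boundGDS d c Cup := by
  unfold GDS boundGDS
  have hCR := CRS_nonneg h.cup_nonneg
  have hsum := sum_split_le n μ (d := d)
  calc ‖∑ k : Fin (d + 1) → Fin n, termDS n σ a τ μ k p‖
      ≤ ∑ k : Fin (d + 1) → Fin n, ‖termDS n σ a τ μ k p‖ := norm_sum_le _ _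
    _ ≤ ∑ k : Fin (d + 1) → Fin n, c⁻¹ * (12 * CRS Cup)
          * (omega n (k μ) ^ (-(3 / 2 : ℝ)) * ∏ i : Fin d, 24 * omega n (k (μ.succAbove i)) ^ (-(sD d))) :=
        Finset.sum_le_sum (fun k _ => norm_termDS_le h a hp hc hE τ μ k)
    _ = c⁻¹ * (12 * CRS Cup) * ∑ k : Fin (d + 1) → Fin n,
          (omega n (k μ) ^ (-(3 / 2 : ℝ)) * ∏ i : Fin d, 24 * omega n (k (μ.succAbove i)) ^ (-(sD d))) := by
        rw [Finset.mul_sum]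
    _ ≤ c⁻¹ * (12 * CRS Cup) * (2 * zetaS (3 / 2) * (48 * zetaS (sD d)) ^ d) :=
        mul_le_mul_of_nonneg_left hsum (by positivity)

/-! ### §3 Joint holomorphy on the fat region -/

/-- one differentiated term is holomorphic (jointly) at every fat point where `ES ≠ 0`. [folklore] -/
theorem differentiableAt_termDS [NeZero n] (h : SymbS n σ r CS Cup) (a : ℝ) {q : Fin (d + 1) → ℂ} (hq : q ∈ Fat (d + 1) r)
    (hE : ES n σ a q ≠ 0) (τ : Fin (d + 1) → Fin n) (μ : Fin (d + 1)) (k : Fin (d + 1) → Fin n) :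
    DifferentiableAt ℂ (termDS n σ a τ μ k) q := by
  show DifferentiableAt ℂ (fun p => D n (k μ : ℕ) (p μ) * termS n σ a τ k p) q
  have h1 : DifferentiableAt ℂ (fun p : Fin (d + 1) → ℂ => D n (k μ : ℕ) (p μ)) q :=
    DifferentiableAt.comp (g := D n (k μ : ℕ)) (f := fun p : Fin (d + 1) → ℂ => p μ) q
      ((differentiable_D n (k μ)) (q μ)) (differentiableAt_apply (𝕜 := ℂ) μ q)
  exact h1.mul (differentiableAt_termS h a hq hE τ k)

/-- **the differentiated class multiplier is holomorphic (jointly) at every fat point where `ES ≠ 0`.** [folklore] -/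
theorem differentiableAt_GDS [NeZero n] (h : SymbS n σ r CS Cup) (a : ℝ) {q : Fin (d + 1) → ℂ} (hq : q ∈ Fat (d + 1) r)
    (hE : ES n σ a q ≠ 0) (τ : Fin (d + 1) → Fin n) (μ : Fin (d + 1)) : DifferentiableAt ℂ (GDS n σ a τ μ) q := by
  show DifferentiableAt ℂ (fun p => ∑ k : Fin (d + 1) → Fin n, termDS n σ a τ μ k p) q
  apply DifferentiableAt.fun_sum
  intro k _
  exact differentiableAt_termDS h a hq hE τ μ k

/-! ### §4 Periodicity across the sides of the strip -/

/-- **SIDE PERIODICITY OF ONE DIFFERENTIATED TERM over the class**: `termDS_k(p + 2πe_{μ′}) = termDS_{σ_{μ′}k}(p)` at a strip point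
`|Im p_ν| ≤ κ ≤ 2r` with `Re p_{μ′} = −π`, `ES ≠ 0` at both points (file 67's `termS_tr_side` + b04's `D_tr`). [folklore] -/
theorem termDS_tr_side [NeZero n] (h : SymbS n σ r CS Cup) (a : ℝ) {κ : ℝ} (hκ : κ ≤ 2 * r) {p : Fin (d + 1) → ℂ}
    (hp : p ∈ Strip (d + 1) κ) (μ' : Fin (d + 1)) (hre : (p μ').re = -Real.pi) (hE0 : ES n σ a p ≠ 0)
    (hE1 : ES n σ a (tr p μ') ≠ 0) (τ : Fin (d + 1) → Fin n) (μ : Fin (d + 1)) (k : Fin (d + 1) → Fin n) :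
    termDS n σ a τ μ k (tr p μ') = termDS n σ a τ μ (sigma n μ' k) p := by
  unfold termDS
  rw [D_tr, termS_tr_side h a hκ hp μ' hre hE0 hE1 τ k]

/-- **SIDE PERIODICITY OF THE DIFFERENTIATED CLASS MULTIPLIER**: `GDS(p + 2πe_{μ′}) = GDS(p)` at the strip points with `Re p_{μ′} = −π`. [folklore] -/
theorem GDS_tr_side [NeZero n] (h : SymbS n σ r CS Cup) (a : ℝ) {κ : ℝ} (hκ : κ ≤ 2 * r) {p : Fin (d + 1) → ℂ}
    (hp : p ∈ Strip (d + 1) κ) (μ' : Fin (d + 1)) (hre : (p μ').re = -Real.pi) (hE0 : ES n σ a p ≠ 0)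
    (hE1 : ES n σ a (tr p μ') ≠ 0) (τ : Fin (d + 1) → Fin n) (μ : Fin (d + 1)) :
    GDS n σ a τ μ (tr p μ') = GDS n σ a τ μ p := by
  unfold GDS
  calc ∑ k : Fin (d + 1) → Fin n, termDS n σ a τ μ k (tr p μ')
      = ∑ k : Fin (d + 1) → Fin n, termDS n σ a τ μ (sigma n μ' k) p :=
        Finset.sum_congr rfl (fun k _ => termDS_tr_side h a hκ hp μ' hre hE0 hE1 τ μ k)
    _ = ∑ k : Fin (d + 1) → Fin n, termDS n σ a τ μ k p :=
        Equiv.sum_comp (sigmaEquiv n μ') (fun k => termDS n σ a τ μ k p)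

/-! ### §5 Strip regularity and the decay of the lattice kernel of the second quantity -/

/-- **STRIP REGULARITY OF THE DIFFERENTIATED CLASS MULTIPLIER**: on any strip `Strip (d+1) κ`, `0 ≤ κ ≤ r`, on which `‖ES‖ ≥ c > 0`,
`GDS n σ a τ μ` is `StripRegular` with bound `boundGDS d c C_up` — every `σ ∈ S`, `a`, `τ`, `μ`. [folklore] -/
theorem stripRegular_GDS [NeZero n] (h : SymbS n σ r CS Cup) (a : ℝ) (τ : Fin (d + 1) → Fin n) (μ : Fin (d + 1))
    {κ c : ℝ} (hκ0 : 0 ≤ κ) (hκr : κ ≤ r) (hc : 0 < c) (hE : ∀ p ∈ Strip (d + 1) κ, c ≤ ‖ES n σ a p‖) :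
    StripRegular (d := d) (GDS n σ a τ μ) κ (boundGDS d c Cup) := by
  have hfat : Strip (d + 1) κ ⊆ Fat (d + 1) r := strip_subset_fat h.r_pos.le hκr
  have hκ2 : κ ≤ 2 * r := by linarith [h.r_pos]
  have hne : ∀ p ∈ Strip (d + 1) κ, ES n σ a p ≠ 0 := by
    intro p hp e
    have := hE p hp
    rw [e, norm_zero] at this
    linarith
  have hdiffAt : ∀ p ∈ Strip (d + 1) κ, DifferentiableAt ℂ (GDS n σ a τ μ) p := fun p hp =>
    differentiableAt_GDS h a (hfat hp) (hne p hp) τ μ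
  refine ⟨?_, ?_, ?_, ?_⟩
  · exact fun p hp => (hdiffAt p hp).continuousAt.continuousWithinAt
  · intro i q hq z hz
    have hP : i.insertNth z (ofRealVec q) ∈ Strip (d + 1) κ :=
      insertNth_mem_Strip hκ0 i hq (openRect_subset_closedRect κ hz)
    exact ((hdiffAt _ hP).comp z (differentiableAt_insertNth i _ z)).differentiableWithinAt
  · intro i q hq y hy
    obtain ⟨hP, hre⟩ := insertNth_left_mem hκ0 i hq hy
    rw [← tr_insertNth_left]
    have hP' := tr_mem_Strip hP i hre
    exact (GDS_tr_side h a hκ2 hP i hre (hne _ hP) (hne _ hP') τ μ).symm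
  · intro p hp
    exact norm_GDS_le h a (hfat hp) hc (hE p hp) τ μ

/-- **THE DIFFERENTIATED CLASS MULTIPLIER ON THE CLASS STRIP**: `StripRegular (GDS n σ a τ μ) κ_S(d+1, a₋, a₊, C_up, r)
(boundGDS d (cS (d+1) a₋) C_up)` for every `σ ∈ S`, `a ∈ [a₋,a₊]`, `τ`, `μ`. [folklore] -/
theorem GDS_stripRegular [NeZero n] (h : SymbS n σ r CS Cup) {aminus aplus a : ℝ} (ha : 0 < aminus) (ha1 : aminus ≤ a)
    (ha2 : a ≤ aplus) (τ : Fin (d + 1) → Fin n) (μ : Fin (d + 1)) :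
    StripRegular (d := d) (GDS n σ a τ μ) (kappaS (d + 1) aminus aplus Cup r) (boundGDS d (cS (d + 1) aminus) Cup) :=
  stripRegular_GDS h a τ μ (kappaS_pos (d + 1) ha h.cup_nonneg h.r_pos).le (kappaS_le (d + 1) aminus aplus Cup r)
    (cS_pos (d + 1) ha) (uniformStrip h ha ha1 ha2)

/-- **B4 (2.35), SECOND QUANTITY, OVER THE CLASS — THE DECAY OF THE LATTICE KERNEL OF `∂^ξ_μ(σ + aQ*Q)⁻¹Q*`'s MULTIPLIER**: for
`0 < a₋ ≤ a ≤ a₊`, EVERY `n ≥ 1`, EVERY `σ ∈ S(n; r, C_S, C_up)`, every `τ`, `μ`, `x ∈ ℤ^{d+1}`: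
`‖latticeKernel (GDS n σ a τ μ) x‖ ≤ boundGDS·e^{−κ_S|x|_∞}`, constants functions of `(d, a₋, a₊, r, C_up)` ALONE. [folklore] -/
theorem dkernelS_decay [NeZero n] (h : SymbS n σ r CS Cup) {aminus aplus a : ℝ} (ha : 0 < aminus) (ha1 : aminus ≤ a)
    (ha2 : a ≤ aplus) (τ : Fin (d + 1) → Fin n) (μ : Fin (d + 1)) (x : Fin (d + 1) → ℤ) :
    ‖latticeKernel (GDS n σ a τ μ) x‖
      ≤ boundGDS d (cS (d + 1) aminus) Cup * Real.exp (-(kappaS (d + 1) aminus aplus Cup r * supNorm x)) :=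
  latticeKernel_decay (GDS_stripRegular h ha ha1 ha2 τ μ) (kappaS_pos (d + 1) ha h.cup_nonneg h.r_pos).le x

/-- Euclidean form (rate `κ_S∕√(d+1)` in `|x|_2`). [folklore] -/
theorem dkernelS_decay_euclid [NeZero n] (h : SymbS n σ r CS Cup) {aminus aplus a : ℝ} (ha : 0 < aminus)
    (ha1 : aminus ≤ a) (ha2 : a ≤ aplus) (τ : Fin (d + 1) → Fin n) (μ : Fin (d + 1)) (x : Fin (d + 1) → ℤ) :
    ‖latticeKernel (GDS n σ a τ μ) x‖ ≤ boundGDS d (cS (d + 1) aminus) Cup *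
      Real.exp (-(kappaS (d + 1) aminus aplus Cup r / Real.sqrt (d + 1) * Real.sqrt (∑ i, ((x i : ℝ)) ^ 2))) :=
  latticeKernel_decay_euclid (GDS_stripRegular h ha ha1 ha2 τ μ) (kappaS_pos (d + 1) ha h.cup_nonneg h.r_pos).le
    (boundGDS_nonneg _ (cS_pos _ ha) h.cup_nonneg) x

end Summit.QuantumFields.BalabanUV.T4Continuum.NE7K1LinStripClassSumsDeriv

end
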